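import Summits.BirchSwinnertonDyer.BirchSwinnertonDyer.Theorems.PrintCf2RubinValueTwoKatzMeasureJZeroFrameSeven
import Literature.NumberTheory.EllipticCurves.DeShalit1987.RayClassTowerDiagonalSplit
import Literature.NumberTheory.GaloisRepresentations.HeckeCharacterDictionary
import HarnessLib

/-!
# FRAME-7, conjugate side: `v̄ = (1 − α₀)`, the split-prime datum `(π₀, π₁) = (α₀, 1 − α₀)` of the (N1)/B10f lane, and
# `𝔪_M ≤ (π₁³)` for the lane moduli `𝔪_M = ∏_{w ∈ S ∪ {v̄}} w^{M+1}` (tame set `S = ∅` included)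

Cell `bsd-print-cf2`, width seat `bsd-line-cf2-p1-w5` g18; print leaf stmt-BirchSwinnertonDyer-24720 (`j = 0` twin), crux 20368.
`--supports stmt-BirchSwinnertonDyer-24720` (helper, Theses-free).  THEOREMS ONLY (no `def`, no named fact, no `sorry`); nothing is
closed; no summit statement is proved by this seat; BSD is not proved by any of this.

WHY: the (N1) chain / B10f-e read the CM descent at the split prime through ABSTRACT elements `π₀ π₁ : 𝓞 K` with
`v = (π₀)`, `π₀ + π₁ = 1`, `2 = π₀π₁`, `π₀` prime, `π₀ ∤ π₁`, and — after LEAD ruling R-N1-S∅ (2026-08-30) — `π₁` prime with the lane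
modulus `𝔪 ≤ (π₁³)` in place of the former `∀ k, 2^k ∉ 𝔪` (false when `S = ∅`).  At the frame (FRAME-7: `v = (α₀)`, `α₀² − α₀ + 2 = 0`)
these are `π₀ := α₀`, `π₁ := 1 − α₀`; this file discharges every one of them, and the `β_K` with `β_K α₀ ≡ 1 (mod 𝔪)`:

* ★ `vbar_asIdeal_eq_span_one_sub` — **`v̄ = (1 − α₀)`** (`(2) = v·v̄` for the split prime of a quadratic field,
  `span_natCast_eq_mul_of_finrank_eq_two`, against `(2) = (α₀)(1 − α₀)`, cancelled in the Dedekind monoid of ideals);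
* `prime_one_sub_of_generator` (`1 − α₀` prime), `prime_of_generator` (`α₀` prime), `two_eq_generator_mul_one_sub`,
  `generator_add_one_sub`, `not_dvd_one_sub_of_generator` (`α₀ ∤ 1 − α₀`) — the split-prime block of B10f-e VERBATIM;
* `modulusIdeal_insert_le_pow` / ★ `modulusIdeal_insert_le_span_one_sub_pow` — **`𝔪_M ≤ v̄^{M+1} ≤ ((1 − α₀)ⁿ)` for `n ≤ M + 1`**
  (so `(hprime₁, h𝔪π₁)` of `DivisionPointsKernelMembershipVbarCube` hold at every lane level with `M + 1 ≥ 3`, `S = ∅` included);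
* `exists_mul_generator_sub_one_mem` — `∃ β_K, β_K·α₀ − 1 ∈ 𝔪` for `v ∤ 𝔪`.

## References
* [deShalit1987] E. de Shalit, *Iwasawa theory of elliptic curves with complex multiplication* (1987), II.1.10, II §4.1 (the split prime
  `p = 𝔭𝔭̄`), II §4.4 (iv).
* [NeukirchANT1999] J. Neukirch, *Algebraic Number Theory* (1999), Ch. I §8 Prop. (8.2)–(8.3), Ch. I §3 (3.1).
-/

-- the summit namespace `Summit.BirchSwinnertonDyer.BirchSwinnertonDyer` repeats the problem name by design (D-0017)
set_option linter.dupNamespace false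
set_option autoImplicit false

noncomputable section

open scoped Classical
open NumberField IsDedekindDomain
open Literature.NumberTheory.EllipticCurves Literature.NumberTheory.GaloisRepresentations

namespace Summit.BirchSwinnertonDyer.BirchSwinnertonDyer.Theorems.PrintCf2.KatzMeasureJZeroTop

variable {K : Type} [Field K] [NumberField K] {v vbar : HeightOneSpectrum (𝓞 K)} {α₀ : 𝓞 K}

/-! ### §1. `v̄ = (1 − α₀)` and the split-prime block -/

omit [NumberField K] in
/-- `2 = α₀·(1 − α₀)` from `α₀² − α₀ + 2 = 0`. [cite: deShalit1987, II §4.1] -/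
theorem two_eq_generator_mul_one_sub (hα₀ : α₀ ^ 2 - α₀ + 2 = 0) : (2 : 𝓞 K) = α₀ * (1 - α₀) := by
  linear_combination hα₀

omit [NumberField K] in
/-- `α₀ + (1 − α₀) = 1`. [cite: deShalit1987, II §4.1] -/
theorem generator_add_one_sub (α₀ : 𝓞 K) : α₀ + (1 - α₀) = 1 := by ring

/-- ★ **`v̄ = (1 − α₀)`**: for `[K:ℚ] = 2` and `2 = v·v̄` split with `v = (α₀)`, `α₀² − α₀ + 2 = 0`, the conjugate prime is generated by
`1 − α₀` (`(2) = v·v̄ = (α₀)·(1 − α₀)`, cancel `v` in the monoid of ideals of the Dedekind domain `𝓞_K`).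
[cite: NeukirchANT1999, Ch. I §8 Prop. (8.2)–(8.3)] [cite: deShalit1987, II §4.1] -/
theorem vbar_asIdeal_eq_span_one_sub (hK : IsImaginaryQuadratic K) (hv : ((2 : ℕ) : 𝓞 K) ∈ v.asIdeal)
    (hvbar : ((2 : ℕ) : 𝓞 K) ∈ vbar.asIdeal) (hne : vbar ≠ v) (hα : v.asIdeal = Ideal.span {α₀}) (hα₀ : α₀ ^ 2 - α₀ + 2 = 0) :
    vbar.asIdeal = Ideal.span {1 - α₀} := by
  have h2 := DeShalit1987.span_natCast_eq_mul_of_finrank_eq_two (p := 2) (v := v) (vbar := vbar) hK.1 Nat.prime_two hv hvbar hne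
  have h2' : Ideal.span {((2 : ℕ) : 𝓞 K)} = v.asIdeal * Ideal.span {1 - α₀} := by
    rw [hα, Ideal.span_singleton_mul_span_singleton, ← two_eq_generator_mul_one_sub hα₀, Nat.cast_ofNat]
  exact mul_left_cancel₀ v.ne_bot (h2.symm.trans h2')

omit [NumberField K] in
/-- `α₀` is prime (`v = (α₀)` is a non-zero prime ideal). [cite: NeukirchANT1999, Ch. I §3 (3.1)] -/
theorem prime_of_generator (hα : v.asIdeal = Ideal.span {α₀}) : Prime α₀ := by
  have h0 : α₀ ≠ 0 := fun h => v.ne_bot (by rw [hα, h, Ideal.span_singleton_eq_bot])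
  exact (Ideal.span_singleton_prime h0).mp (hα ▸ v.isPrime)

/-- ★ `1 − α₀` is prime (`v̄ = (1 − α₀)`) — the hypothesis `hprime₁` of `DivisionPointsKernelMembershipVbarCube` at the frame.
[cite: NeukirchANT1999, Ch. I §8 Prop. (8.2)–(8.3)] [cite: deShalit1987, II §4.1] -/
theorem prime_one_sub_of_generator (hK : IsImaginaryQuadratic K) (hv : ((2 : ℕ) : 𝓞 K) ∈ v.asIdeal)
    (hvbar : ((2 : ℕ) : 𝓞 K) ∈ vbar.asIdeal) (hne : vbar ≠ v) (hα : v.asIdeal = Ideal.span {α₀}) (hα₀ : α₀ ^ 2 - α₀ + 2 = 0) :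
    Prime (1 - α₀) :=
  prime_of_generator (v := vbar) (vbar_asIdeal_eq_span_one_sub hK hv hvbar hne hα hα₀)

omit [NumberField K] in
/-- `α₀ ∤ 1 − α₀` (else `α₀ ∣ 1`) — the hypothesis `hndvd`/`hπ₁` of the lane. [cite: deShalit1987, II §4.1] -/
theorem not_dvd_one_sub_of_generator (hα : v.asIdeal = Ideal.span {α₀}) : ¬ α₀ ∣ 1 - α₀ := by
  intro h
  have h1 : α₀ ∣ 1 := by
    have := dvd_add (dvd_refl α₀) h
    rwa [add_sub_cancel] at this
  exact (prime_of_generator hα).not_unit (isUnit_of_dvd_one h1)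

/-! ### §2. The lane moduli `𝔪_M = ∏_{w ∈ S ∪ {v̄}} w^{M+1}` are divisible by `v̄^{M+1}` -/

omit [NumberField K] in
/-- `𝔪_M ≤ v̄^{M+1}` for `𝔪_M = modulusIdeal (insert v̄ S) (fun _ ↦ M)` (every member of the module of definition divides it).
[cite: deShalit1987, II §4.4 (iv)] -/
theorem modulusIdeal_insert_le_pow (S : Finset (HeightOneSpectrum (𝓞 K))) (M : ℕ) :
    HeckeCharacter.modulusIdeal (insert vbar S) (fun _ ↦ M) ≤ vbar.asIdeal ^ (M + 1) :=
  Ideal.le_of_dvd (HeckeCharacter.pow_dvd_modulusIdeal (fun _ ↦ M) (Finset.mem_insert_self vbar S))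

/-- ★ **`𝔪_M ≤ ((1 − α₀)ⁿ)` for `n ≤ M + 1`** — the hypothesis `h𝔪π₁ : 𝔪 ≤ Ideal.span {π₁ ^ 3}` of
`DivisionPointsKernelMembershipVbarCube` (and `… ^ 2` of `DivisionPointReadingsAtLevelVbarCube`) at every lane level with `M + 1 ≥ n`,
for EVERY tame set `S` (empty or not). [cite: deShalit1987, II §4.4 (iv)] -/
theorem modulusIdeal_insert_le_span_one_sub_pow (hK : IsImaginaryQuadratic K) (hv : ((2 : ℕ) : 𝓞 K) ∈ v.asIdeal)
    (hvbar : ((2 : ℕ) : 𝓞 K) ∈ vbar.asIdeal) (hne : vbar ≠ v) (hα : v.asIdeal = Ideal.span {α₀}) (hα₀ : α₀ ^ 2 - α₀ + 2 = 0)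
    (S : Finset (HeightOneSpectrum (𝓞 K))) {M n : ℕ} (hn : n ≤ M + 1) :
    HeckeCharacter.modulusIdeal (insert vbar S) (fun _ ↦ M) ≤ Ideal.span {(1 - α₀) ^ n} := by
  refine (modulusIdeal_insert_le_pow S M).trans ?_
  rw [vbar_asIdeal_eq_span_one_sub hK hv hvbar hne hα hα₀, ← Ideal.span_singleton_pow]
  exact Ideal.pow_le_pow_right hn

/-! ### §3. `β_K` with `β_K α₀ ≡ 1 (mod 𝔪)` -/

/-- **`∃ β_K, β_K·α₀ − 1 ∈ 𝔪`** for `v = (α₀) ∤ 𝔪` (`(α₀) + 𝔪 = (1)`) — the hypothesis `hβK` of the lane.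
[cite: NeukirchANT1999, Ch. I §3 (3.1)] [cite: deShalit1987, II §4.4 Definition] -/
theorem exists_mul_generator_sub_one_mem {𝔪 : Ideal (𝓞 K)} (hv𝔪 : ¬ 𝔪 ≤ v.asIdeal) (hα : v.asIdeal = Ideal.span {α₀}) :
    ∃ βK : 𝓞 K, βK * α₀ - 1 ∈ 𝔪 := by
  have htop : Ideal.span {α₀} ⊔ 𝔪 = ⊤ := by
    rw [← hα]
    by_contra h
    exact hv𝔪 ((v.isMaximal.eq_of_le h le_sup_left).symm ▸ le_sup_right)
  have h1 : (1 : 𝓞 K) ∈ Ideal.span {α₀} ⊔ 𝔪 := htop ▸ Submodule.mem_top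
  obtain ⟨y, z, hz, hyz⟩ := Ideal.mem_span_singleton_sup.mp h1
  exact ⟨y, by rw [show y * α₀ - 1 = -z by linear_combination hyz]; exact 𝔪.neg_mem hz⟩

end Summit.BirchSwinnertonDyer.BirchSwinnertonDyer.Theorems.PrintCf2.KatzMeasureJZeroTop

end
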